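import Mathlib.Data.Real.Basic
import Mathlib.Algebra.BigOperators.Fin
import Mathlib.Tactic
import Literature.Analysis.FluidPDE.FluidComputer.ThresholdGate
import Literature.Analysis.FluidPDE.FluidComputer.ThresholdLevelCertificate
import HarnessLib

/-!
# The two-gate toy chain field of the R1-K kernel (layer T): exact field, Taylor split, entrywise bound

HONEST FRAMING (cell `pub-fluidc`, blueprint seat bp3, gen 18): low prior, high value-of-information
experiment on Tao's machine paradigm; NOT a claim that NS blows up. Pure algebra about an explicit
9-dimensional quadratic vector field; nothing here is about the Navier–Stokes equations.

WHAT. The 9-mode chain `(a₁,b₁,c₁,d₁,a₂,b₂,c₂,d₂,e₂) = X 0 … X 8` of two threshold gates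
(`thresholdCircuit`, gate data `g : GateData`), the downstream one run at coupling ratio `Λ`
(its rates carry the factor `Λ`), joined by the handshake `d₁ → a₂` (`∂ₜd₁ ∋ -κ d₁ a₂`,
`∂ₜa₂ ∋ κ d₁²`): `ChainField.F g Λ`. This is the EXACT field whose coefficient table the bp3 gen-18
kernel twin (`code/thgate/g18/kgen.py`, `TERMS`) evaluates in dyadic interval arithmetic; the kernel
instance is `F Gt LT` with the dyadic coupling `LT = 6369051672525773/2^50` (the design ratio is
`2^{5/2}`; the toy chain is DEFINED with `LT`).  Proved here, all by `ring`/`linarith`: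
* `taylor_split`: `F (X + E) = F X + J X E + F E` with the explicit Jacobian action `J` (exact second
  order Taylor formula of a homogeneous quadratic: the remainder IS `F E`) — hypothesis shape of
  `ImplicitMajorant.step` (`V = J e + F e + δF − d`);
* `abs_F_le`: `|E i| ≤ W i ⇒ |F E i| ≤ Fabs W i` with `Fabs` the same table with absolute coefficients —
  the kernel's quadratic-remainder forcing `φ ∋ |A P̃| Fabs(Ē)`;
* `J_symm`, `J_self`, `smul_sq` (homogeneity), `energy` (`∑ Xᵢ Fᵢ(X) = 0`: the handshake is
  conservative), and the identification of the two halves with `thresholdCircuit`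
  (`F_up₀…₃`, `F_down₀…₄`).

[cite: Tao2016AveragedNS, §5.5 Thm 5.3 (5.5); §6.1 Remark 6.1]
-/

noncomputable section

open Finset BigOperators

namespace Summit.NavierStokesRegularity.FluidComputer

open Literature.Analysis.FluidPDE.FluidComputer

namespace ChainField

/-- The dyadic coupling ratio of the kernel's toy chain (`≈ 2^{5/2} = 5.656854…`). [folklore] -/
def LT : ℝ := 6369051672525773 / 2 ^ 50

/-- **The chain field** on `(a₁,b₁,c₁,d₁,a₂,b₂,c₂,d₂,e₂)`. [cite: Tao2016AveragedNS, §5.5 (5.5)] -/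
def F (g : GateData) (Λ : ℝ) (X : Fin 9 → ℝ) : Fin 9 → ℝ :=
  ![-(g.ε * X 0 * X 1) - g.σ * X 0 * X 2 + g.μ * X 2 ^ 2 - g.r * X 2 * X 3,
    g.ε * X 0 ^ 2 - g.ν * X 2 ^ 2,
    g.σ * X 0 ^ 2 + g.ν * X 1 * X 2 - g.μ * X 0 * X 2,
    g.r * X 0 * X 2 - g.κ * X 3 * X 4,
    g.κ * X 3 ^ 2 - Λ * g.ε * X 4 * X 5 - Λ * g.σ * X 4 * X 6 + Λ * g.μ * X 6 ^ 2 - Λ * g.r * X 6 * X 7,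
    Λ * g.ε * X 4 ^ 2 - Λ * g.ν * X 6 ^ 2,
    Λ * g.σ * X 4 ^ 2 + Λ * g.ν * X 5 * X 6 - Λ * g.μ * X 4 * X 6,
    Λ * g.r * X 4 * X 6 - Λ * g.κ * X 7 * X 8,
    Λ * g.κ * X 7 ^ 2]

/-- The Jacobian of `F` at `X` applied to `E` (the symmetric bilinear form polarising `F`). [folklore] -/
def J (g : GateData) (Λ : ℝ) (X E : Fin 9 → ℝ) : Fin 9 → ℝ :=
  ![-(g.ε * (X 0 * E 1 + E 0 * X 1)) - g.σ * (X 0 * E 2 + E 0 * X 2) + 2 * g.μ * X 2 * E 2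
      - g.r * (X 2 * E 3 + E 2 * X 3),
    2 * g.ε * X 0 * E 0 - 2 * g.ν * X 2 * E 2,
    2 * g.σ * X 0 * E 0 + g.ν * (X 1 * E 2 + E 1 * X 2) - g.μ * (X 0 * E 2 + E 0 * X 2),
    g.r * (X 0 * E 2 + E 0 * X 2) - g.κ * (X 3 * E 4 + E 3 * X 4),
    2 * g.κ * X 3 * E 3 - Λ * g.ε * (X 4 * E 5 + E 4 * X 5) - Λ * g.σ * (X 4 * E 6 + E 4 * X 6)
      + 2 * Λ * g.μ * X 6 * E 6 - Λ * g.r * (X 6 * E 7 + E 6 * X 7),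
    2 * Λ * g.ε * X 4 * E 4 - 2 * Λ * g.ν * X 6 * E 6,
    2 * Λ * g.σ * X 4 * E 4 + Λ * g.ν * (X 5 * E 6 + E 5 * X 6) - Λ * g.μ * (X 4 * E 6 + E 4 * X 6),
    Λ * g.r * (X 4 * E 6 + E 4 * X 6) - Λ * g.κ * (X 7 * E 8 + E 7 * X 8),
    2 * Λ * g.κ * X 7 * E 7]

/-- The entrywise absolute table: `Fabs W` bounds `|F E|` entrywise when `|E| ≤ W`. [folklore] -/
def Fabs (g : GateData) (Λ : ℝ) (W : Fin 9 → ℝ) : Fin 9 → ℝ :=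
  ![|g.ε| * W 0 * W 1 + |g.σ| * W 0 * W 2 + |g.μ| * W 2 ^ 2 + |g.r| * W 2 * W 3,
    |g.ε| * W 0 ^ 2 + |g.ν| * W 2 ^ 2,
    |g.σ| * W 0 ^ 2 + |g.ν| * W 1 * W 2 + |g.μ| * W 0 * W 2,
    |g.r| * W 0 * W 2 + |g.κ| * W 3 * W 4,
    |g.κ| * W 3 ^ 2 + |Λ * g.ε| * W 4 * W 5 + |Λ * g.σ| * W 4 * W 6 + |Λ * g.μ| * W 6 ^ 2
      + |Λ * g.r| * W 6 * W 7,
    |Λ * g.ε| * W 4 ^ 2 + |Λ * g.ν| * W 6 ^ 2,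
    |Λ * g.σ| * W 4 ^ 2 + |Λ * g.ν| * W 5 * W 6 + |Λ * g.μ| * W 4 * W 6,
    |Λ * g.r| * W 4 * W 6 + |Λ * g.κ| * W 7 * W 8,
    |Λ * g.κ| * W 7 ^ 2]

variable (g : GateData) (Λ : ℝ)

/-- **Exact Taylor split** of the homogeneous quadratic field: `F(X+E) = F X + J X E + F E`. [folklore] -/
theorem taylor_split (X E : Fin 9 → ℝ) : F g Λ (X + E) = F g Λ X + J g Λ X E + F g Λ E := by
  ext i; fin_cases i <;> simp [F, J] <;> ring

/-- The increment form used by the kernel: `F(X+E) − F X = J X E + F E`. [folklore] -/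
theorem sub_eq (X E : Fin 9 → ℝ) : F g Λ (X + E) - F g Λ X = J g Λ X E + F g Λ E := by
  rw [taylor_split]; abel

/-- `J` is symmetric (it polarises `F`). [folklore] -/
theorem J_symm (X E : Fin 9 → ℝ) : J g Λ X E = J g Λ E X := by
  ext i; fin_cases i <;> simp [J] <;> ring

/-- Euler identity `J X X = 2 F X`. [folklore] -/
theorem J_self (X : Fin 9 → ℝ) : J g Λ X X = (2 : ℝ) • F g Λ X := by
  ext i; fin_cases i <;> simp [F, J] <;> ring

/-- `J X` is additive in its second argument. [folklore] -/
theorem J_add (X E E' : Fin 9 → ℝ) : J g Λ X (E + E') = J g Λ X E + J g Λ X E' := by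
  ext i; fin_cases i <;> simp [J] <;> ring

/-- `J X (c • E) = c • J X E`. [folklore] -/
theorem J_smul (X E : Fin 9 → ℝ) (c : ℝ) : J g Λ X (c • E) = c • J g Λ X E := by
  ext i; fin_cases i <;> simp [J] <;> ring

/-- Homogeneity of degree two (level scaling). [folklore] -/
theorem smul_sq (X : Fin 9 → ℝ) (c : ℝ) : F g Λ (c • X) = (c ^ 2) • F g Λ X := by
  ext i; fin_cases i <;> simp [F] <;> ring

/-- **Energy identity**: the chain conserves `∑ Xᵢ²/2` (the handshake `d₁ → a₂` is conservative,
each gate is cancelling). [folklore] -/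
theorem energy (X : Fin 9 → ℝ) : ∑ i, X i * F g Λ X i = 0 := by
  simp [F, Fin.sum_univ_succ]
  ring

/-- Upstream carrier equation = the gate's. [folklore] -/
theorem F_up₀ (X : Fin 9 → ℝ) :
    F g Λ X 0 = thresholdCircuit g.ε g.σ g.ν g.μ g.r g.κ ![X 0, X 1, X 2, X 3, X 4] 0 := by
  simp [F, thresholdCircuit]; ring

/-- Upstream clock equation = the gate's. [folklore] -/
theorem F_up₁ (X : Fin 9 → ℝ) :
    F g Λ X 1 = thresholdCircuit g.ε g.σ g.ν g.μ g.r g.κ ![X 0, X 1, X 2, X 3, X 4] 1 := by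
  simp [F, thresholdCircuit]

/-- Upstream trigger equation = the gate's. [folklore] -/
theorem F_up₂ (X : Fin 9 → ℝ) :
    F g Λ X 2 = thresholdCircuit g.ε g.σ g.ν g.μ g.r g.κ ![X 0, X 1, X 2, X 3, X 4] 2 := by
  simp [F, thresholdCircuit]

/-- Upstream rotor equation = the gate's (its output mode is the downstream carrier `a₂ = X 4`).
[folklore] -/
theorem F_up₃ (X : Fin 9 → ℝ) :
    F g Λ X 3 = thresholdCircuit g.ε g.σ g.ν g.μ g.r g.κ ![X 0, X 1, X 2, X 3, X 4] 3 := by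
  simp [F, thresholdCircuit]

/-- Downstream carrier: the upstream output pump `κ d₁²` plus `Λ ×` the gate's carrier equation.
[folklore] -/
theorem F_down₀ (X : Fin 9 → ℝ) :
    F g Λ X 4 = g.κ * X 3 ^ 2
      + Λ * thresholdCircuit g.ε g.σ g.ν g.μ g.r g.κ ![X 4, X 5, X 6, X 7, X 8] 0 := by
  simp [F, thresholdCircuit]; ring

/-- Downstream clock = `Λ ×` the gate's. [folklore] -/
theorem F_down₁ (X : Fin 9 → ℝ) :
    F g Λ X 5 = Λ * thresholdCircuit g.ε g.σ g.ν g.μ g.r g.κ ![X 4, X 5, X 6, X 7, X 8] 1 := by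
  simp [F, thresholdCircuit]; ring

/-- Downstream trigger = `Λ ×` the gate's. [folklore] -/
theorem F_down₂ (X : Fin 9 → ℝ) :
    F g Λ X 6 = Λ * thresholdCircuit g.ε g.σ g.ν g.μ g.r g.κ ![X 4, X 5, X 6, X 7, X 8] 2 := by
  simp [F, thresholdCircuit]; ring

/-- Downstream rotor = `Λ ×` the gate's. [folklore] -/
theorem F_down₃ (X : Fin 9 → ℝ) :
    F g Λ X 7 = Λ * thresholdCircuit g.ε g.σ g.ν g.μ g.r g.κ ![X 4, X 5, X 6, X 7, X 8] 3 := by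
  simp [F, thresholdCircuit]; ring

/-- Downstream output = `Λ ×` the gate's. [folklore] -/
theorem F_down₄ (X : Fin 9 → ℝ) :
    F g Λ X 8 = Λ * thresholdCircuit g.ε g.σ g.ν g.μ g.r g.κ ![X 4, X 5, X 6, X 7, X 8] 4 := by
  simp [F, thresholdCircuit]; ring

/-! ### The entrywise quadratic bound `|F E| ≤ Fabs W` -/

/-- `|c a b| ≤ |c| A B` from `|a| ≤ A`, `|b| ≤ B`. [folklore] -/
private theorem t2 {c a b A B : ℝ} (ha : |a| ≤ A) (hb : |b| ≤ B) :
    |c * a * b| ≤ |c| * A * B := by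
  rw [abs_mul, abs_mul]
  have hA : 0 ≤ A := (abs_nonneg a).trans ha
  have h1 : |a| * |b| ≤ A * B := mul_le_mul ha hb (abs_nonneg b) hA
  calc |c| * |a| * |b| = |c| * (|a| * |b|) := by ring
    _ ≤ |c| * (A * B) := mul_le_mul_of_nonneg_left h1 (abs_nonneg c)
    _ = |c| * A * B := by ring

/-- `|c a²| ≤ |c| A²` from `|a| ≤ A`. [folklore] -/
private theorem tsq {c a A : ℝ} (ha : |a| ≤ A) : |c * a ^ 2| ≤ |c| * A ^ 2 := by
  rw [abs_mul, abs_pow]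
  have h1 : |a| ^ 2 ≤ A ^ 2 := pow_le_pow_left₀ (abs_nonneg a) ha 2
  exact mul_le_mul_of_nonneg_left h1 (abs_nonneg c)

/-- **Entrywise bound of the quadratic remainder**: `|E i| ≤ W i` for all `i` implies
`|F E i| ≤ Fabs W i` (triangle inequality termwise). [folklore] -/
theorem abs_F_le {E W : Fin 9 → ℝ} (h : ∀ i, |E i| ≤ W i) (i : Fin 9) :
    |F g Λ E i| ≤ Fabs g Λ W i := by
  rw [abs_le]
  fin_cases i
  · have p01 := abs_le.1 (t2 (c := g.ε) (h 0) (h 1))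
    have p02 := abs_le.1 (t2 (c := g.σ) (h 0) (h 2))
    have p22 := abs_le.1 (tsq (c := g.μ) (h 2))
    have p23 := abs_le.1 (t2 (c := g.r) (h 2) (h 3))
    simp [F, Fabs]; constructor <;> linarith [p01.1, p01.2, p02.1, p02.2, p22.1, p22.2, p23.1, p23.2]
  · have p00 := abs_le.1 (tsq (c := g.ε) (h 0))
    have q22 := abs_le.1 (tsq (c := g.ν) (h 2))
    simp [F, Fabs]; constructor <;> linarith [p00.1, p00.2, q22.1, q22.2]
  · have s00 := abs_le.1 (tsq (c := g.σ) (h 0))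
    have s12 := abs_le.1 (t2 (c := g.ν) (h 1) (h 2))
    have s02 := abs_le.1 (t2 (c := g.μ) (h 0) (h 2))
    simp [F, Fabs]; constructor <;> linarith [s00.1, s00.2, s12.1, s12.2, s02.1, s02.2]
  · have r02 := abs_le.1 (t2 (c := g.r) (h 0) (h 2))
    have r34 := abs_le.1 (t2 (c := g.κ) (h 3) (h 4))
    simp [F, Fabs]; constructor <;> linarith [r02.1, r02.2, r34.1, r34.2]
  · have k33 := abs_le.1 (tsq (c := g.κ) (h 3))
    have d45 := abs_le.1 (t2 (c := Λ * g.ε) (h 4) (h 5))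
    have d46 := abs_le.1 (t2 (c := Λ * g.σ) (h 4) (h 6))
    have d66 := abs_le.1 (tsq (c := Λ * g.μ) (h 6))
    have d67 := abs_le.1 (t2 (c := Λ * g.r) (h 6) (h 7))
    simp [F, Fabs]; simp only [abs_mul] at d45 d46 d66 d67; constructor <;>
      linarith [k33.1, k33.2, d45.1, d45.2, d46.1, d46.2, d66.1, d66.2, d67.1, d67.2]
  · have d44 := abs_le.1 (tsq (c := Λ * g.ε) (h 4))
    have n66 := abs_le.1 (tsq (c := Λ * g.ν) (h 6))
    simp [F, Fabs]; simp only [abs_mul] at d44 n66; constructor <;> linarith [d44.1, d44.2, n66.1, n66.2]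
  · have g44 := abs_le.1 (tsq (c := Λ * g.σ) (h 4))
    have g56 := abs_le.1 (t2 (c := Λ * g.ν) (h 5) (h 6))
    have g46 := abs_le.1 (t2 (c := Λ * g.μ) (h 4) (h 6))
    simp [F, Fabs]; simp only [abs_mul] at g44 g56 g46
    constructor <;> linarith [g44.1, g44.2, g56.1, g56.2, g46.1, g46.2]
  · have w46 := abs_le.1 (t2 (c := Λ * g.r) (h 4) (h 6))
    have w78 := abs_le.1 (t2 (c := Λ * g.κ) (h 7) (h 8))
    simp [F, Fabs]; simp only [abs_mul] at w46 w78; constructor <;> linarith [w46.1, w46.2, w78.1, w78.2]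
  · have z77 := abs_le.1 (tsq (c := Λ * g.κ) (h 7))
    simp [F, Fabs]; simp only [abs_mul] at z77; constructor <;> linarith [z77.1, z77.2]

end ChainField

end Summit.NavierStokesRegularity.FluidComputer
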